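import Literature.NumberTheory.EllipticCurves.ZpExtensionScalarTwist
import Literature.NumberTheory.EllipticCurves.TorsionStructureProofs
import Literature.NumberTheory.GaloisRepresentations.CoeffExtensionZModBasisProofs
import HarnessLib

/-!
# Howard's hypothesis H.0 for the specialised modules: `E[p^k] ⊗ A_{m,k}(ψ)` is a free `A_{m,k}`-module
# of rank two (proved theorems + the explicit basis; no named fact, no instance, no notation)

Topic `NumberTheory/EllipticCurves` (companion of `ZpExtensionScalarTwist` — the pinned carrier
`IwasawaAlgebra.EisensteinCoeff.Twisted p m k M = A_{m,k} ⊗_ℤ M`, `A_{m,k} = Λ/(q_m, p^k)`, of Howard's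
`T_𝔮/p^k T_𝔮` — and of `ZpExtensionScalarTwistFiniteProofs`, whose upper bound `#(M ⊗ A_{m,k}) ≤ p^{kmr}` is
sharpened here to an equality for `M ≅ (ℤ/p^k)^r`).

B. Howard, *The Heegner point Kolyvagin system*, Compositio Math. 140 (2004), §1.3, hypothesis **H.0**:
«`T` is a free `R`-module of rank two» (arXiv:1202.6340 §2.3). For the specialised Selmer triple of the
shared μ-item of cell `pub/bsd-print-x9` at the Eisenstein prime `𝔮 = (T^m + p)` (Howard, proof of
Thm. 2.2.10: «taking `𝔮 = T^m + p`»), the level-`k` coefficient ring is the finite ring `R = A_{m,k}` (a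
principal Artinian quotient of the DVR `S_𝔮 = Λ/𝔮`, `#A_{m,k} = p^{km}`) and the level-`k` module is
`T_𝔮/p^k T_𝔮 = E[p^k] ⊗_ℤ A_{m,k}` (the tree's `Twisted p m k (geomTorsion W (p^k))`, the carrier of
`ZpExtension.eisensteinTwist κ (W.torsionGaloisModule (p^k)) hm k`). Since `p^k = 0` in `A_{m,k}`
(`IwasawaAlgebra.natCast_pow_eq_zero_quotient`) and `E[p^k] ≅ (ℤ/p^k)²` as a group for `p ∤ char F`
(Silverman, *AEC*, Cor. III.6.4(b); tree `WeierstrassCurve.nonempty_geomTorsion_addEquiv_fin_two`), the generic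
base-change lemma `CoeffExtension.basisOfAddEquiv` (Bourbaki, *Algebra* II §5 no. 1 Prop. 4 with II §3 no. 6
Cor. 3) gives:

* `Twisted.basisOfAddEquiv e : Module.Basis ι A_{m,k} (Twisted p m k M)` for any `e : M ≃+ (ι → ZMod (p^k))`,
  the basis `i ↦ 1 ⊗ e⁻¹(δ_i)` (`Twisted.basisOfAddEquiv_apply`); `Twisted.free_of_addEquiv`,
  `Twisted.moduleFinite_of_addEquiv`, `Twisted.finrank_eq_card_of_addEquiv` (`m, k ≥ 1`),
  **`Twisted.natCard_eq_of_addEquiv : #(M ⊗ A_{m,k}) = p^{k·m·|ι|}`**;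
* `nontrivial_eisensteinCoeff` (`m, k ≥ 1`);
* **`WeierstrassCurve.free_twisted_geomTorsion`**, **`WeierstrassCurve.finrank_twisted_geomTorsion_eq_two`**,
  `WeierstrassCurve.natCard_twisted_geomTorsion` (`= p^{2km}`) and the conjunction
  **`WeierstrassCurve.howardH0_twisted_geomTorsion :
    Module.Free A_{m,k} (E[p^k] ⊗ A_{m,k}) ∧ Module.finrank A_{m,k} (E[p^k] ⊗ A_{m,k}) = 2`** —
  hypothesis H.0 VERBATIM in the head `H0 := Module.Free R M ∧ Module.finrank R M = 2` of the cell's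
  (W9)-A typing of Howard §1.3, at every level `k ≥ 1` (`m ≥ 1`, `p ∤ char F`).

The twist `ψ` plays no role (H.0 is a statement about the `R`-module, not the Galois action). Nothing here
asserts anything about Selmer groups; BSD is not proved by any of this.

References: [Howard2004HeegnerKolyvagin] §1.3 H.0, §2.2, proof of Thm. 2.2.10; [SilvermanAEC2009] Cor. III.6.4(b);
[BourbakiAlgebre1a3] Ch. II §5 no. 1 Prop. 4, §3 no. 6 Cor. 3; [Washington1997] §13.2.
-/

noncomputable section

universe u w

namespace Literature.NumberTheory.EllipticCurves

open Literature.NumberTheory.GaloisRepresentations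

namespace IwasawaAlgebra.EisensteinCoeff

variable {p : ℕ} [hp : Fact p.Prime] {m k : ℕ} {M : Type w} [AddCommGroup M] {ι : Type*} [Fintype ι]
  [DecidableEq ι]

/-! ## §1 `p^k = 0` in `A_{m,k}`; `A_{m,k}` is non-trivial for `m, k ≥ 1` -/

omit [Fintype ι] [DecidableEq ι] in
/-- `(p^k : ℕ) = 0` in `A_{m,k} = Λ/(q_m, p^k)` (the tree's `natCast_pow_eq_zero_quotient`, cast form).
[cite: Washington1997, §13.2] [cite: Howard2004HeegnerKolyvagin, §2.2 (T_𝔮/p^k T_𝔮)] -/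
theorem natCast_prime_pow_eq_zero (m k : ℕ) : ((p ^ k : ℕ) : EisensteinCoeff p m k) = 0 := by
  rw [Nat.cast_pow]
  exact natCast_pow_eq_zero_quotient p m k

omit [Fintype ι] [DecidableEq ι] in
/-- **`A_{m,k}` is a non-trivial ring for `m, k ≥ 1`** (`#A_{m,k} = p^{km} > 1`).
[cite: Howard2004HeegnerKolyvagin, proof of Thm. 2.2.10 (𝔮 = T^m + p)] [cite: Washington1997, §13.2 (Prop. 13.8)] -/
theorem nontrivial_eisensteinCoeff (hm : 1 ≤ m) (hk : 1 ≤ k) : Nontrivial (EisensteinCoeff p m k) := by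
  haveI := finite_quotient_span_qm_sup_span_C_pow p hm k
  rw [← Finite.one_lt_card_iff_nontrivial, card_quotient_span_qm_sup_span_C_pow p hm k]
  exact Nat.one_lt_pow (Nat.mul_ne_zero (by omega) (by omega)) hp.out.one_lt

/-! ## §2 `M ⊗ A_{m,k}` is free over `A_{m,k}` with basis `1 ⊗ e⁻¹(δ_i)` when `M ≅ (ℤ/p^k)^ι` -/

/-- **The `A_{m,k}`-basis `i ↦ 1 ⊗ e⁻¹(δ_i)` of `M ⊗ A_{m,k}`** attached to an additive isomorphism
`e : M ≃ (ℤ/p^k)^ι` (generic `CoeffExtension.basisOfAddEquiv` at `A = A_{m,k}`, where `p^k = 0`).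
[cite: Howard2004HeegnerKolyvagin, §1.3 hypothesis H.0 (arXiv:1202.6340 §2.3)] [cite: BourbakiAlgebre1a3, Ch. II §5 no. 1 Prop. 4] -/
def Twisted.basisOfAddEquiv (e : M ≃+ (ι → ZMod (p ^ k))) :
    Module.Basis ι (EisensteinCoeff p m k) (Twisted p m k M) :=
  CoeffExtension.basisOfAddEquiv (natCast_prime_pow_eq_zero m k) e

/-- The basis vectors are the pure tensors `1 ⊗ e⁻¹(δ_i)`.
[cite: Howard2004HeegnerKolyvagin, §1.3 hypothesis H.0 (arXiv:1202.6340 §2.3)] [cite: BourbakiAlgebre1a3, Ch. II §5 no. 1 Prop. 4] -/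
theorem Twisted.basisOfAddEquiv_apply (e : M ≃+ (ι → ZMod (p ^ k))) (i : ι) :
    Twisted.basisOfAddEquiv (m := m) e i = Twisted.tmul (1 : EisensteinCoeff p m k) (e.symm (Pi.single i 1)) :=
  CoeffExtension.basisOfAddEquiv_apply (natCast_prime_pow_eq_zero m k) e i

/-- Coordinates in the basis: `repr (c ⊗ x) i = c · e(x)_i`.
[cite: Howard2004HeegnerKolyvagin, §1.3 hypothesis H.0 (arXiv:1202.6340 §2.3)] [cite: BourbakiAlgebre1a3, Ch. II §5 no. 1 Prop. 4] -/
theorem Twisted.basisOfAddEquiv_repr_tmul (e : M ≃+ (ι → ZMod (p ^ k))) (c : EisensteinCoeff p m k) (x : M)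
    (i : ι) : (Twisted.basisOfAddEquiv e).repr (Twisted.tmul c x) i = c * (ZMod.cast (e x i) : EisensteinCoeff p m k) :=
  CoeffExtension.basisOfAddEquiv_repr_tmul (natCast_prime_pow_eq_zero m k) e c x i

/-- **`M ⊗ A_{m,k}` is a free `A_{m,k}`-module** when `M ≅ (ℤ/p^k)^ι` additively.
[cite: Howard2004HeegnerKolyvagin, §1.3 hypothesis H.0 (arXiv:1202.6340 §2.3)] [cite: BourbakiAlgebre1a3, Ch. II §5 no. 1 Prop. 4] -/
theorem Twisted.free_of_addEquiv (e : M ≃+ (ι → ZMod (p ^ k))) :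
    Module.Free (EisensteinCoeff p m k) (Twisted p m k M) :=
  CoeffExtension.free_of_addEquiv (natCast_prime_pow_eq_zero m k) e

/-- `M ⊗ A_{m,k}` is finitely generated over `A_{m,k}` when `M ≅ (ℤ/p^k)^ι` additively.
[cite: Howard2004HeegnerKolyvagin, §1.3 hypothesis H.0 (arXiv:1202.6340 §2.3)] [cite: BourbakiAlgebre1a3, Ch. II §5 no. 1 Prop. 4] -/
theorem Twisted.moduleFinite_of_addEquiv (e : M ≃+ (ι → ZMod (p ^ k))) :
    Module.Finite (EisensteinCoeff p m k) (Twisted p m k M) :=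
  CoeffExtension.moduleFinite_of_addEquiv (natCast_prime_pow_eq_zero m k) e

/-- **`rank_{A_{m,k}} (M ⊗ A_{m,k}) = |ι|`** when `M ≅ (ℤ/p^k)^ι` additively (`m, k ≥ 1`).
[cite: Howard2004HeegnerKolyvagin, §1.3 hypothesis H.0 (arXiv:1202.6340 §2.3)] [cite: BourbakiAlgebre1a3, Ch. II §5 no. 1 Prop. 4] -/
theorem Twisted.finrank_eq_card_of_addEquiv (hm : 1 ≤ m) (hk : 1 ≤ k) (e : M ≃+ (ι → ZMod (p ^ k))) :
    Module.finrank (EisensteinCoeff p m k) (Twisted p m k M) = Fintype.card ι := by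
  haveI := nontrivial_eisensteinCoeff (p := p) hm hk
  exact CoeffExtension.finrank_eq_card_of_addEquiv (natCast_prime_pow_eq_zero m k) e

/-- **`#(M ⊗ A_{m,k}) = p^{k·m·|ι|}`** when `M ≅ (ℤ/p^k)^ι` additively (`m ≥ 1`; equality case of the tree's
`natCard_twisted_le_pow`). [cite: Howard2004HeegnerKolyvagin, §2.2 and proof of Thm. 2.2.10 (𝔮 = T^m + p)] [cite: BourbakiAlgebre1a3, Ch. II §5 no. 1 Prop. 4] -/
theorem Twisted.natCard_eq_of_addEquiv (hm : 1 ≤ m) (e : M ≃+ (ι → ZMod (p ^ k))) :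
    Nat.card (Twisted p m k M) = p ^ (k * m * Fintype.card ι) := by
  have h := CoeffExtension.natCard_eq_pow_of_addEquiv (natCast_prime_pow_eq_zero (p := p) m k) e
  rw [card_quotient_span_qm_sup_span_C_pow p hm k, ← pow_mul] at h
  exact h

end IwasawaAlgebra.EisensteinCoeff

end Literature.NumberTheory.EllipticCurves

/-! ## §3 H.0 for `E[p^k] ⊗ A_{m,k}(ψ)` -/

namespace WeierstrassCurve

open Literature.NumberTheory.EllipticCurves Literature.NumberTheory.EllipticCurves.IwasawaAlgebra
open Literature.NumberTheory.EllipticCurves.IwasawaAlgebra.EisensteinCoeff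

variable {F : Type u} [Field F] (W : WeierstrassCurve F) [W.IsElliptic] {p : ℕ} [hp : Fact p.Prime] {m : ℕ}

omit hp in
/-- **`E[p^k] ≅ (ℤ/p^k)²` as a group**, in the spelling `geomTorsion W ((p : ℤ)^k)` of the tree's
`torsionGaloisModule ((p : ℤ)^k)` (`p ∤ char F`; Silverman, *AEC*, Cor. III.6.4(b), tree
`nonempty_geomTorsion_addEquiv_fin_two` transported along `((p^k : ℕ) : ℤ) = (p : ℤ)^k`).
[cite: SilvermanAEC2009, Cor. III.6.4(b)] -/
theorem nonempty_geomTorsion_prime_pow_addEquiv_fin_two (hpF : (p : F) ≠ 0) (k : ℕ) :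
    Nonempty (geomTorsion W ((p : ℤ) ^ k) ≃+ (Fin 2 → ZMod (p ^ k))) := by
  have hpk : ((p ^ k : ℕ) : F) ≠ 0 := by
    rw [Nat.cast_pow]
    exact pow_ne_zero k hpF
  obtain ⟨e⟩ := W.nonempty_geomTorsion_addEquiv_fin_two hpk
  have h : geomTorsion W ((p : ℤ) ^ k) = geomTorsion W ((p ^ k : ℕ) : ℤ) := by
    rw [Nat.cast_pow]
  exact ⟨(AddEquiv.addSubgroupCongr h).trans e⟩

/-- **`E[p^k] ⊗ A_{m,k}` is a free `A_{m,k}`-module** (`p ∤ char F`) — Howard's H.0, freeness clause, for the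
level-`k` specialised module `T_𝔮/p^k T_𝔮`. [cite: Howard2004HeegnerKolyvagin, §1.3 hypothesis H.0 (arXiv:1202.6340 §2.3) and §2.2 (T_𝔮 = T_p E ⊗ S_𝔮)] [cite: SilvermanAEC2009, Cor. III.6.4(b)] -/
theorem free_twisted_geomTorsion (hpF : (p : F) ≠ 0) (k : ℕ) :
    Module.Free (EisensteinCoeff p m k) (Twisted p m k (geomTorsion W ((p : ℤ) ^ k))) := by
  obtain ⟨e⟩ := W.nonempty_geomTorsion_prime_pow_addEquiv_fin_two hpF k
  exact Twisted.free_of_addEquiv e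

/-- `E[p^k] ⊗ A_{m,k}` is finitely generated over `A_{m,k}` (`p ∤ char F`). [cite: Howard2004HeegnerKolyvagin, §1.3 hypothesis H.0 (arXiv:1202.6340 §2.3) and §2.2] [cite: SilvermanAEC2009, Cor. III.6.4(b)] -/
theorem moduleFinite_twisted_geomTorsion (hpF : (p : F) ≠ 0) (k : ℕ) :
    Module.Finite (EisensteinCoeff p m k) (Twisted p m k (geomTorsion W ((p : ℤ) ^ k))) := by
  obtain ⟨e⟩ := W.nonempty_geomTorsion_prime_pow_addEquiv_fin_two hpF k
  exact Twisted.moduleFinite_of_addEquiv e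

/-- **`rank_{A_{m,k}} (E[p^k] ⊗ A_{m,k}) = 2`** (`m, k ≥ 1`, `p ∤ char F`) — Howard's H.0, rank clause.
[cite: Howard2004HeegnerKolyvagin, §1.3 hypothesis H.0 (arXiv:1202.6340 §2.3) and §2.2 (T_𝔮 = T_p E ⊗ S_𝔮)] [cite: SilvermanAEC2009, Cor. III.6.4(b)] -/
theorem finrank_twisted_geomTorsion_eq_two (hpF : (p : F) ≠ 0) (hm : 1 ≤ m) {k : ℕ} (hk : 1 ≤ k) :
    Module.finrank (EisensteinCoeff p m k) (Twisted p m k (geomTorsion W ((p : ℤ) ^ k))) = 2 := by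
  obtain ⟨e⟩ := W.nonempty_geomTorsion_prime_pow_addEquiv_fin_two hpF k
  rw [Twisted.finrank_eq_card_of_addEquiv hm hk e, Fintype.card_fin]

/-- **`#(E[p^k] ⊗ A_{m,k}) = p^{2km}`** (`m ≥ 1`, `p ∤ char F`): the order of `T_𝔮/p^k T_𝔮`.
[cite: Howard2004HeegnerKolyvagin, §2.2 and proof of Thm. 2.2.10 (𝔮 = T^m + p)] [cite: SilvermanAEC2009, Cor. III.6.4(b)] -/
theorem natCard_twisted_geomTorsion (hpF : (p : F) ≠ 0) (hm : 1 ≤ m) (k : ℕ) :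
    Nat.card (Twisted p m k (geomTorsion W ((p : ℤ) ^ k))) = p ^ (2 * k * m) := by
  obtain ⟨e⟩ := W.nonempty_geomTorsion_prime_pow_addEquiv_fin_two hpF k
  rw [Twisted.natCard_eq_of_addEquiv hm e, Fintype.card_fin]
  ring_nf

/-- **Howard's hypothesis H.0 for the specialised module at every finite level**: for `m, k ≥ 1` and
`p ∤ char F`, `T_𝔮/p^k T_𝔮 = E[p^k] ⊗ A_{m,k}` is a free `A_{m,k}`-module of rank two — in the exact head
`Module.Free R M ∧ Module.finrank R M = 2` of the cell's typing of Howard §1.3 (`R = A_{m,k}`).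
[cite: Howard2004HeegnerKolyvagin, §1.3 hypothesis H.0 (arXiv:1202.6340 §2.3, p0007) and proof of Thm. 2.2.10 (𝔮 = T^m + p)] [cite: SilvermanAEC2009, Cor. III.6.4(b)] -/
theorem howardH0_twisted_geomTorsion (hpF : (p : F) ≠ 0) (hm : 1 ≤ m) {k : ℕ} (hk : 1 ≤ k) :
    Module.Free (EisensteinCoeff p m k) (Twisted p m k (geomTorsion W ((p : ℤ) ^ k))) ∧
      Module.finrank (EisensteinCoeff p m k) (Twisted p m k (geomTorsion W ((p : ℤ) ^ k))) = 2 :=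
  ⟨W.free_twisted_geomTorsion hpF k, W.finrank_twisted_geomTorsion_eq_two hpF hm hk⟩

end WeierstrassCurve

end
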